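import Summits.BirchSwinnertonDyer.BirchSwinnertonDyer.Theorems.SignedLowerHalvesSmallImageLowerHalfBothSignsRttCharRoadE2OfParts
import HarnessLib

/-!
# Route `SignedLowerHalves`, crux L `SmallImageLowerHalfBothSigns` (stmt-BirchSwinnertonDyer-23599), line `rtt_w3` v13 — E2, LEAD:
# THE E2 GLUE IN LOCALISATION FORM — `charRoad_E2_of_localisation`: the four-term sequence collapsed to ONE map `gX : Q → X'`

WHY (BRIEF-E2 rev 3 §2–§3, `Lines/rtt_w3-BRIEF-E2-g9.md`; LEAD analysis after the glue `charRoad_E2_of_parts`, p775611). In the glue's four-term input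
`H →ᶠ Q →ᵍ X' →ʰ Y → 0` one may always take `H := ker g`, `f :=` the inclusion and `Y := coker g`, `h :=` the projection: exactness is then
TAUTOLOGICAL, and when `Q ≅ Λ_𝒪` (the `ε`-Coleman map) the global term `H = ker g ⊆ Q` is AUTOMATICALLY torsion-free of `Λ_𝒪`-rank `≤ 1`. So the whole
(PT)+(K) input of E2 is ONE `Λ_𝒪`-linear map `gX : Q → X'` (the dual-of-localisation map `𝐇¹_v/E^ε → 𝔛^ε_θ`, resp. `(𝒰_∞/V^∓)_θ → 𝔛^ε_{rel,θ}` of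
class field theory), the zeta element `z ∈ Q` with `gX z = 0` («`loc_v z_θ` is a global class»), and the Euler-system-EASY inequality in KERNEL/COKERNEL currency
`λ(ker gX ⧸ Λ_𝒪 z) ≤ λ(X' ⧸ gX(Q))` — which, given (Col)+(an), is EQUIVALENT to E2 (no slack: `λ(X') − λ(Λ_𝒪/(Col z)) = λ(coker gX) − λ(ker gX/Λ_𝒪 z)`).
* ★★★ `charRoad_E2_of_localisation`: the E2-tail's conclusion from `gX`, `z`, `hK`, `Col`, (an) — `X'` here a `Λ_𝒪`-module with its scalar-tower
  `Λ`-structure, finitely generated torsion over `Λ` (transfer to the stub's `Dψ.X` by `lambdaInvariant_eq_of_finite_ker_coker(_semilinear)` /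
  `lambdaInvariant_eq_of_addEquiv`).
THEOREMS ONLY; the inputs are HYPOTHESES (the research content of E2); crux L, crux M, E2 and BSD remain OPEN and are proved for NO curve by any of this.
[cite: Kobayashi2003, Thm. 7.3 i), Thm. 1.3] [cite: PollackRubin2004, §6–§7, Theorem (p. 448)] [cite: Washington1997, §13.2]
-/

set_option linter.dupNamespace false -- D-0017: single-problem summit, the namespace repeats the problem name by design
set_option autoImplicit false

noncomputable section

open scoped Classical MatrixGroups ModularForm

namespace Summit.BirchSwinnertonDyer.BirchSwinnertonDyer.Theorems.SmallImageRttCharRoad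

open PowerSeries Literature.NumberTheory.EllipticCurves Literature.NumberTheory.IwasawaTheory
  Literature.NumberTheory.EllipticCurves.GreenbergVatsal2000 CongruenceSubgroup NumberField IsDedekindDomain Rat.HeightOneSpectrum
  Literature.NumberTheory.EllipticCurves.ModularForms

variable {p : ℕ} [Fact p.Prime] {S : Set (PadicAlgCl p)} [Algebra (IwasawaAlgebra p) (IwasawaAlgebraO S)]

/-- **The E2 glue in localisation form.** Data: `Λ_𝒪`-modules `Q` (the signed local quotient, `Col : Q ≃ₗ[Λ_𝒪] Λ_𝒪`) and `X'` (the `θ`-line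
Selmer-type dual, finitely generated torsion over `Λ`), with the scalar-tower `Λ`-structures; ONE `Λ_𝒪`-linear map `gX : Q → X'`; the zeta element `z ∈ Q`
with `gX z = 0`; the inequality `hK : λ(ker gX ⧸ Λ_𝒪∙z) ≤ λ(X' ⧸ range gX)`; and the analytic identification (an) of `Col z` as in
`charRoad_E2_of_parts`. Then the E2-tail's conclusion holds with `λ(X')` on the right. Proof: `charRoad_E2_of_parts` with `H := ker gX ↪ Q`,
`Y := X' ⧸ range gX` (exactness tautological; `ker gX ⊆ Q ≅ Λ_𝒪` is torsion-free of rank `≤ 1`).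
[cite: Kobayashi2003, Thm. 7.3 i), Thm. 1.3] [cite: PollackRubin2004, §6–§7, Theorem (p. 448)] [cite: GreenbergVatsal2000, §2 Prop. (2.4)] -/
theorem charRoad_E2_of_localisation (hS : 0 < Module.finrank ℚ_[p] (padicCoeffField S))
    (halg : ∀ r : IwasawaAlgebra p, algebraMap (IwasawaAlgebra p) (IwasawaAlgebraO S) r = iwasawaToIwasawaO S r)
    {M : ℕ} [NeZero M] (g : CuspForm (Gamma0 M) 2) (ι : coeffField g →+* PadicAlgCl p) (hng : IsNewform0 g)
    (S₀ : Finset (HeightOneSpectrum (𝓞 ℚ)))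
    {Q X' : Type} [AddCommGroup Q] [AddCommGroup X']
    [Module (IwasawaAlgebraO S) Q] [Module (IwasawaAlgebra p) Q] [IsScalarTower (IwasawaAlgebra p) (IwasawaAlgebraO S) Q]
    [Module (IwasawaAlgebraO S) X'] [Module (IwasawaAlgebra p) X'] [IsScalarTower (IwasawaAlgebra p) (IwasawaAlgebraO S) X']
    [Module.Finite (IwasawaAlgebra p) X'] (hX' : Module.IsTorsion (IwasawaAlgebra p) X')
    (gX : Q →ₗ[IwasawaAlgebraO S] X') (z : Q) (hz : gX z = 0)
    (hK : lambdaInvariant p (LinearMap.ker gX ⧸ Submodule.span (IwasawaAlgebraO S) {(⟨z, hz⟩ : LinearMap.ker gX)}) ≤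
      lambdaInvariant p (X' ⧸ LinearMap.range gX))
    (Col : Q ≃ₗ[IwasawaAlgebraO S] IwasawaAlgebraO S)
    (L : IwasawaAlgebraO (Set.range ι)) (hL : L ≠ 0) {c : PadicAlgCl p} (hc : c ≠ 0)
    (fv : HeightOneSpectrum (𝓞 ℚ) → ℤ_[p])
    (hfv : ∀ v ∈ S₀, fv v ≠ 0 ∧ (fv v).valuation = (frobeniusExponent p (natGenerator v : ℤ_[p])).valuation)
    (hCol : iwasawaOToPowerSeries S (Col z) =
      PowerSeries.C c * iwasawaOToPowerSeries (Set.range ι) L *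
        ∏ v ∈ S₀, Polynomial.aeval (PowerSeries.C ((natGenerator v : PadicAlgCl p)⁻¹) *
            (PowerSeries.binomialSeries ℤ_[p] (fv v)).map (algebraMap ℤ_[p] (PadicAlgCl p)))
          (1 - Polynomial.C (embCoeff g ι (natGenerator v)) * Polynomial.X +
            (if natGenerator v ∣ M then 0 else Polynomial.C (natGenerator v : PadicAlgCl p)) * Polynomial.X ^ 2)) :
    ∃ d : ℕ, (∀ k : ℕ, ‖PowerSeries.coeff k (iwasawaOToPowerSeries (Set.range ι) L)‖ ≤
        ‖PowerSeries.coeff d (iwasawaOToPowerSeries (Set.range ι) L)‖) ∧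
      (∀ k : ℕ, k < d → ‖PowerSeries.coeff k (iwasawaOToPowerSeries (Set.range ι) L)‖ <
        ‖PowerSeries.coeff d (iwasawaOToPowerSeries (Set.range ι) L)‖) ∧
      Module.finrank ℚ_[p] (padicCoeffField S) * (d + ∑ v ∈ S₀, p ^ (frobeniusExponent p (natGenerator v : ℤ_[p])).valuation *
        layerLambda ((1 - Polynomial.C (embCoeff g ι (natGenerator v)) * Polynomial.X +
          (if natGenerator v ∣ M then 0 else Polynomial.C (natGenerator v : PadicAlgCl p)) * Polynomial.X ^ 2).comp
            (Polynomial.C ((natGenerator v : PadicAlgCl p)⁻¹) * (Polynomial.X + 1)))) ≤ lambdaInvariant p X' := by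
  -- `ker gX ⊆ Q ≅ Λ_𝒪` is torsion-free of rank `≤ 1`
  haveI : NoZeroSMulDivisors (IwasawaAlgebraO S) Q := by
    refine ⟨fun {c x} h ↦ ?_⟩
    have h' : c * Col x = 0 := by rw [← smul_eq_mul, ← map_smul, h, map_zero]
    exact (mul_eq_zero.mp h').imp_right fun hx ↦ Col.injective (by rw [hx, map_zero])
  haveI : NoZeroSMulDivisors (IwasawaAlgebraO S) (LinearMap.ker gX) :=
    ⟨fun {c x} h ↦ (eq_zero_or_eq_zero_of_smul_eq_zero (c := c) (x := (x : Q))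
      (by rw [← Submodule.coe_smul, h, Submodule.coe_zero])).imp_right fun hx ↦ Subtype.ext hx⟩
  have hrank : Module.rank (IwasawaAlgebraO S) (LinearMap.ker gX) ≤ 1 :=
    (Submodule.rank_le _).trans (by rw [Col.rank_eq, Module.rank_self])
  -- the tautological four-term sequence `ker gX ↪ Q → X' ↠ X' ⧸ range gX`
  have hfg : Function.Exact (LinearMap.ker gX).subtype (gX.restrictScalars (IwasawaAlgebra p)) :=
    LinearMap.exact_subtype_ker_map gX
  have hgh : Function.Exact (gX.restrictScalars (IwasawaAlgebra p))
      ((LinearMap.range gX).mkQ.restrictScalars (IwasawaAlgebra p)) :=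
    LinearMap.exact_map_mkQ_range gX
  have hh : Function.Surjective ((LinearMap.range gX).mkQ.restrictScalars (IwasawaAlgebra p)) :=
    fun x ↦ Submodule.mkQ_surjective (LinearMap.range gX) x
  have hCol' : iwasawaOToPowerSeries S (Col ((LinearMap.ker gX).subtype ⟨z, hz⟩)) =
      PowerSeries.C c * iwasawaOToPowerSeries (Set.range ι) L *
        ∏ v ∈ S₀, Polynomial.aeval (PowerSeries.C ((natGenerator v : PadicAlgCl p)⁻¹) *
            (PowerSeries.binomialSeries ℤ_[p] (fv v)).map (algebraMap ℤ_[p] (PadicAlgCl p)))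
          (1 - Polynomial.C (embCoeff g ι (natGenerator v)) * Polynomial.X +
            (if natGenerator v ∣ M then 0 else Polynomial.C (natGenerator v : PadicAlgCl p)) * Polynomial.X ^ 2) := by
    rw [Submodule.subtype_apply]
    exact hCol
  -- the glue with `H := ker gX`, `Y := X' ⧸ range gX`
  exact charRoad_E2_of_parts hS halg g ι hng S₀ hX' (LinearMap.ker gX).subtype (gX.restrictScalars (IwasawaAlgebra p))
    ((LinearMap.range gX).mkQ.restrictScalars (IwasawaAlgebra p)) hfg hgh hh hrank ⟨z, hz⟩ hK Col L hL hc fv hfv hCol'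

end Summit.BirchSwinnertonDyer.BirchSwinnertonDyer.Theorems.SmallImageRttCharRoad

end
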